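import Literature.Combinatorics.Designs.GoethalsSeidelArray

/-!
# Hadamard 668 census — the (+) control H(428) certified in the kernel through the Goethals–Seidel plug-in

Framing: lottery ticket; floor = certified bounds/negative ranges.

Cell pub-namedobj (venture DiscreteObjects), target (H).  The census's (+) control for the T-sequence / Goethals–Seidel
family is the order-428 matrix of Kharaghani–Tayfeh-Rezaie (2005): the published Turyn-type sequences TT(36) (hex
`000f0f51c9bbd750cb048e3902185ca6a96`, Best–Đoković–Kharaghani–Ramp 2013) give base sequences, T-sequences of length
107 and, by Cooper–Wallis, four `±1` circulant first rows `a, b, c, d` of length 107 with autocorrelations summing to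
zero; the cell derived these rows with two independent engines (hadamard V1/V2, verify-ref E2, lead third engine; file
`certs/H668/GS107_abcd.txt`, row sums 13, 3, −9, −13, 13² + 3² + 9² + 13² = 428).  Here the rows are entered as bit
masks, the Goethals–Seidel condition `Σ PAF = 0` at all 106 non-zero shifts is checked by `decide`, and the formalised
Goethals–Seidel theorem (`goethalsSeidel_isHadamard`, Literature/…/GoethalsSeidelArray) turns it into a kernel-certified
Hadamard matrix of order 428 — the same structural route by which a hit at `v = 167` would be certified at order 668.
Ours (certificate of a published object); no `sorry`, no `native_decide`.
-/

open Matrix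

namespace Summit.Ventures.DiscreteObjects.Hadamard

open Literature.Combinatorics.Designs.LegendrePairs (PAF IsPM)
open Literature.Combinatorics.Designs.GoethalsSeidel (gsMatrix IsHadamardMatrix goethalsSeidel_isHadamard)

/-- `±1` sequence of length 107 from a bit mask (bit `i` set ↦ `-1`) -/
def seqOfMask (m : ℕ) (i : ZMod 107) : ℤ := if Nat.testBit m i.val then -1 else 1

/-- such a sequence is `±1`-valued -/
lemma isPM_seqOfMask (m : ℕ) : IsPM (seqOfMask m) := fun i => by
  unfold seqOfMask; split <;> simp

/-- first GS row of the order-428 control (T-sequences of length 107 from TT(36), Cooper–Wallis combination `a`) -/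
def r428a : ZMod 107 → ℤ := seqOfMask 34571196598010025429977150925864
/-- second GS row (`b`) -/
def r428b : ZMod 107 → ℤ := seqOfMask 47543310501746035637151686579159
/-- third GS row (`c`) -/
def r428c : ZMod 107 → ℤ := seqOfMask 34571196599142748328619956622295
/-- fourth GS row (`d`) -/
def r428d : ZMod 107 → ℤ := seqOfMask 114715966326334604855684573811671

set_option maxRecDepth 100000 in
set_option maxHeartbeats 40000000 in
/-- the Goethals–Seidel condition for the four rows, at every non-zero shift, by kernel evaluation -/
theorem r428_gs : ∀ s : ZMod 107, s ≠ 0 → PAF r428a s + PAF r428b s + PAF r428c s + PAF r428d s = 0 := by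
  decide

/-- **H(428) certified**: the Goethals–Seidel array on the four rows is a Hadamard matrix of order
`428 = |Fin 4 × ZMod 107|` (Kharaghani–Tayfeh-Rezaie 2005, re-derived by the cell; here kernel-checked). -/
theorem hadamard428_certificate :
    IsHadamardMatrix (gsMatrix r428a r428b r428c r428d) ∧ Fintype.card (Fin 4 × ZMod 107) = 428 :=
  ⟨goethalsSeidel_isHadamard _ _ _ _ (isPM_seqOfMask _) (isPM_seqOfMask _) (isPM_seqOfMask _) (isPM_seqOfMask _)
    r428_gs, by simp [ZMod.card]⟩

end Summit.Ventures.DiscreteObjects.Hadamard
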